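import Mathlib

/-!
# `DivisionGap.PerMultiplesHard` (stmt-ValiantsHypothesis-5068), line `uncharged-face-walk`:
σ-heavy tables (stub `stub_heavyTable`)

Host `G ⊆ [n]²` (cells `(row, column)`), `σ` a perfect matching inside `G` (`(σ j, j) ∈ G`),
margins `(R, C)` feasible on `G` (some `G`-supported table `M₀` has them), close
(`|R_i − C_j| ≤ w` for all `i, j`) and of offset `n·w ≤ C_j`.  Claim: some `G`-supported table
with margins `(R, C)` carries `≥ C_j − n·w` on every pattern cell `(σ j, j)`.

Proof: put `m_j := C_j − n·w` on `(σ j, j)` and solve the residual transportation problem with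
margins `r_i := R_i + n·w − C_{σ⁻¹ i}`, `c_j := n·w` by the supply–demand criterion (taken as the
first hypothesis).  Its Hall condition for a row set `X`: `N_G(X) ⊇ σ⁻¹(X)`; if `N_G(X)` has a
further column then `c(N_G(X)) ≥ (#X + 1)·n·w ≥ r(X)` because every `r_i ≤ n·w + w` and
`#X·w ≤ n·w`; if `N_G(X) = σ⁻¹(X)` then `r(X) ≤ c(N_G(X))` reads `R(X) ≤ C(σ⁻¹ X) = C(N_G(X))`,
witnessed by the feasible table `M₀` (its rows `X` live in the columns `N_G(X)`).  The answer is
the residual table plus the pattern table `(σ j, j) ↦ m_j`.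
-/

noncomputable section

set_option linter.dupNamespace false

namespace Summit.ValiantsHypothesis.ValiantsHypothesis.Theorems.DivisionGap.PerMultiplesHard.HeavyTable

open scoped BigOperators

open Finset

/-- Double counting: a table with row sums `R` and column sums `C` has `Σ R = Σ C`. [folklore] -/
theorem sum_rows_eq_sum_cols {n : ℕ} (R C : Fin n → ℕ) (M₀ : (Fin n × Fin n) →₀ ℕ)
    (hrow : ∀ i, ∑ j, M₀ (i, j) = R i) (hcol : ∀ j, ∑ i, M₀ (i, j) = C j) :
    ∑ i, R i = ∑ j, C j := by
  calc ∑ i, R i = ∑ i, ∑ j, M₀ (i, j) := by simp_rw [hrow]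
    _ = ∑ j, ∑ i, M₀ (i, j) := sum_comm
    _ = ∑ j, C j := by simp_rw [hcol]

/-- Easy direction of the supply–demand criterion: the rows `X` of a `G`-supported table live in
the columns `N_G(X)` seen by `X` through `G`, so `R(X) ≤ C(N_G(X))`. [folklore] -/
theorem rows_le_neighbour_cols {n : ℕ} (G : Finset (Fin n × Fin n)) (R C : Fin n → ℕ)
    (M₀ : (Fin n × Fin n) →₀ ℕ) (hsupp : M₀.support ⊆ G) (hrow : ∀ i, ∑ j, M₀ (i, j) = R i)
    (hcol : ∀ j, ∑ i, M₀ (i, j) = C j) (X : Finset (Fin n)) :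
    ∑ i ∈ X, R i ≤ ∑ j ∈ univ.filter (fun j : Fin n => ∃ i ∈ X, (i, j) ∈ G), C j := by
  have h1 : ∀ i ∈ X,
      R i = ∑ j ∈ univ.filter (fun j : Fin n => ∃ i ∈ X, (i, j) ∈ G), M₀ (i, j) := by
    intro i hi
    rw [← hrow i]
    symm
    refine sum_subset (subset_univ _) fun j _ hj => ?_
    by_contra hne
    exact hj (mem_filter.2 ⟨mem_univ _, i, hi, hsupp (Finsupp.mem_support_iff.2 hne)⟩)
  calc ∑ i ∈ X, R i
        = ∑ i ∈ X, ∑ j ∈ univ.filter (fun j : Fin n => ∃ i ∈ X, (i, j) ∈ G), M₀ (i, j) :=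
          sum_congr rfl h1
    _ = ∑ j ∈ univ.filter (fun j : Fin n => ∃ i ∈ X, (i, j) ∈ G), ∑ i ∈ X, M₀ (i, j) :=
          sum_comm
    _ ≤ ∑ j ∈ univ.filter (fun j : Fin n => ∃ i ∈ X, (i, j) ∈ G), ∑ i, M₀ (i, j) :=
          sum_le_sum fun j _ => sum_le_sum_of_subset (subset_univ X)
    _ = ∑ j ∈ univ.filter (fun j : Fin n => ∃ i ∈ X, (i, j) ∈ G), C j :=
          sum_congr rfl fun j _ => hcol j

/-- **σ-heavy tables.**  Given the supply–demand criterion (first hypothesis), a host `G ⊆ [n]²`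
with a perfect matching `σ` inside (`(σ j, j) ∈ G`), margins `(R, C)` that are feasible on `G`
(some `G`-supported table has them), close (`|R_i − C_j| ≤ w`) and of offset `n·w ≤ C_j`: there
is a `G`-supported table `M` with margins `(R, C)` and `C_j ≤ M(σ j, j) + n·w` for every column
`j`.  Proof: put `m_j := C_j − n·w` on `(σ j, j)` and solve the residual transportation problem
with margins `r_i := R_i + n·w − C_{σ⁻¹ i}`, `c_j := n·w`: for a row set `X`, `N_G(X) ⊇ σ⁻¹(X)`;
if `N_G(X)` has a further column then `c(N_G(X)) ≥ (#X + 1)·n·w ≥ r(X)` because every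
`r_i ≤ n·w + w`; if `N_G(X) = σ⁻¹(X)` exactly then `r(X) ≤ c(N_G(X))` reads
`R(X) ≤ C(σ⁻¹ X) = C(N_G(X))`, which the feasible table witnesses.  Add the two tables.
[folklore] -/
theorem stub_heavyTable :
    (∀ (n : ℕ) (G : Finset (Fin n × Fin n)) (r c : Fin n → ℕ), ∑ i, r i = ∑ j, c j →
      (∀ X : Finset (Fin n),
        ∑ i ∈ X, r i ≤ ∑ j ∈ Finset.univ.filter (fun j : Fin n => ∃ i ∈ X, (i, j) ∈ G), c j) →
      ∃ M : (Fin n × Fin n) →₀ ℕ, M.support ⊆ G ∧ (∀ i, ∑ j, M (i, j) = r i) ∧ (∀ j, ∑ i, M (i, j) = c j)) →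
    ∀ (n w : ℕ) (G : Finset (Fin n × Fin n)) (σ : Equiv.Perm (Fin n)) (R C : Fin n → ℕ),
      (∀ j, (σ j, j) ∈ G) →
      (∃ M₀ : (Fin n × Fin n) →₀ ℕ, M₀.support ⊆ G ∧ (∀ i, ∑ j, M₀ (i, j) = R i) ∧ (∀ j, ∑ i, M₀ (i, j) = C j)) →
      (∀ i j, R i ≤ C j + w ∧ C j ≤ R i + w) →
      (∀ j, n * w ≤ C j) →
      ∃ M : (Fin n × Fin n) →₀ ℕ, M.support ⊆ G ∧ (∀ i, ∑ j, M (i, j) = R i) ∧ (∀ j, ∑ i, M (i, j) = C j) ∧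
        ∀ j, C j ≤ M (σ j, j) + n * w := by
  intro hT n w G σ R C hσ hM₀ hclose hoff
  obtain ⟨M₀, hsupp₀, hrow₀, hcol₀⟩ := hM₀
  /- Basic inequalities: `w ≤ n·w` (rows exist only for `n ≥ 1`) and `C (σ⁻¹ i) ≤ R i + n·w`. -/
  have hwn : ∀ _i : Fin n, w ≤ n * w := fun i => Nat.le_mul_of_pos_left w (Fin.pos i)
  have hCR : ∀ i : Fin n, C (σ.symm i) ≤ R i + n * w := fun i =>
    (hclose i (σ.symm i)).2.trans (by have := hwn i; omega)
  have hsumRC : ∑ i, R i = ∑ j, C j := sum_rows_eq_sum_cols R C M₀ hrow₀ hcol₀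
  /- The residual row margins `r i := R i + n·w − C (σ⁻¹ i)`, recorded by their defining
  equation. -/
  obtain ⟨r, hr⟩ : ∃ r : Fin n → ℕ, ∀ i, r i + C (σ.symm i) = R i + n * w :=
    ⟨fun i => R i + n * w - C (σ.symm i), fun i => by have := hCR i; dsimp only; omega⟩
  /- Balance `Σ r = n·(n·w)`. -/
  have hbal : ∑ i, r i = ∑ _j : Fin n, n * w := by
    have h1 : ∑ i, (r i + C (σ.symm i)) = ∑ i, (R i + n * w) := sum_congr rfl fun i _ => hr i
    rw [sum_add_distrib, sum_add_distrib, Equiv.sum_comp σ.symm C, ← hsumRC] at h1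
    omega
  /- Hall's condition for the residual problem. -/
  have hHall : ∀ X : Finset (Fin n),
      ∑ i ∈ X, r i ≤ ∑ j ∈ univ.filter (fun j : Fin n => ∃ i ∈ X, (i, j) ∈ G), n * w := by
    intro X
    set N := univ.filter (fun j : Fin n => ∃ i ∈ X, (i, j) ∈ G) with hN
    have hsub : X.image σ.symm ⊆ N := by
      intro j hj
      rw [mem_image] at hj
      obtain ⟨i, hi, rfl⟩ := hj
      rw [hN, mem_filter]
      refine ⟨mem_univ _, i, hi, ?_⟩
      have := hσ (σ.symm i)
      rwa [Equiv.apply_symm_apply] at this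
    have hcardimg : (X.image σ.symm).card = X.card :=
      card_image_of_injective X σ.symm.injective
    have hcard : X.card ≤ N.card := hcardimg ▸ card_le_card hsub
    have hcN : ∑ _j ∈ N, n * w = N.card * (n * w) := by simp
    rw [hcN]
    rcases Nat.lt_or_ge X.card N.card with hlt | hge
    · /- Slack case: a further column pays for everything. -/
      have hri : ∀ i ∈ X, r i ≤ n * w + w := by
        intro i _
        have := (hclose i (σ.symm i)).1
        have := hr i
        omega
      have hXn : X.card ≤ n := by simpa using card_le_univ X
      calc ∑ i ∈ X, r i ≤ ∑ _i ∈ X, (n * w + w) := sum_le_sum hri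
        _ = X.card * (n * w) + X.card * w := by simp [mul_add]
        _ ≤ X.card * (n * w) + n * w := by gcongr
        _ = (X.card + 1) * (n * w) := by ring
        _ ≤ N.card * (n * w) := Nat.mul_le_mul_right _ hlt
    · /- Tight case: `N = σ⁻¹(X)`, and the feasible table `M₀` witnesses `R(X) ≤ C(N)`. -/
      have hEq : X.image σ.symm = N :=
        eq_of_subset_of_card_le hsub (by rw [hcardimg]; exact hge)
      have h1 : ∑ i ∈ X, R i ≤ ∑ i ∈ X, C (σ.symm i) := by
        calc ∑ i ∈ X, R i ≤ ∑ j ∈ N, C j :=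
              rows_le_neighbour_cols G R C M₀ hsupp₀ hrow₀ hcol₀ X
          _ = ∑ j ∈ X.image σ.symm, C j := by rw [hEq]
          _ = ∑ i ∈ X, C (σ.symm i) := sum_image fun x _ y _ h => σ.symm.injective h
      have h2 : ∑ i ∈ X, (r i + C (σ.symm i)) = ∑ i ∈ X, (R i + n * w) :=
        sum_congr rfl fun i _ => hr i
      rw [sum_add_distrib, sum_add_distrib] at h2
      have h3 : ∑ _i ∈ X, n * w = X.card * (n * w) := by simp
      rw [h3] at h2
      have hNX : N.card = X.card := le_antisymm hge hcard
      rw [hNX]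
      omega
  /- The residual table. -/
  obtain ⟨M₁, hsupp₁, hrow₁, hcol₁⟩ := hT n G r (fun _ => n * w) hbal hHall
  /- The pattern table `(σ j, j) ↦ C j − n·w`. -/
  obtain ⟨P, hP⟩ : ∃ P : (Fin n × Fin n) →₀ ℕ,
      ∀ p, P p = if σ p.2 = p.1 then C p.2 - n * w else 0 :=
    ⟨Finsupp.equivFunOnFinite.symm fun p => if σ p.2 = p.1 then C p.2 - n * w else 0,
      fun p => by simp⟩
  refine ⟨M₁ + P, ?_, ?_, ?_, ?_⟩
  · /- Support inside `G`. -/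
    intro p hp
    by_contra hpG
    rw [Finsupp.mem_support_iff, Finsupp.add_apply] at hp
    apply hp
    have h1 : M₁ p = 0 := by
      by_contra h
      exact hpG (hsupp₁ (Finsupp.mem_support_iff.2 h))
    have h2 : P p = 0 := by
      rw [hP]
      split_ifs with h
      · exact absurd (by simpa [h] using hσ p.2) hpG
      · rfl
    rw [h1, h2, add_zero]
  · /- Row sums. -/
    intro i
    simp only [Finsupp.add_apply]
    rw [sum_add_distrib, hrow₁ i]
    have h1 : ∑ j, P (i, j) = C (σ.symm i) - n * w := by
      simp_rw [hP]
      simp only [Equiv.apply_eq_iff_eq_symm_apply, sum_ite_eq', mem_univ, if_true]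
    rw [h1]
    have := hr i
    have := hCR i
    have := hoff (σ.symm i)
    omega
  · /- Column sums. -/
    intro j
    simp only [Finsupp.add_apply]
    rw [sum_add_distrib, hcol₁ j]
    have h1 : ∑ i, P (i, j) = C j - n * w := by
      simp_rw [hP]
      simp only [sum_ite_eq, mem_univ, if_true]
    rw [h1]
    have := hoff j
    omega
  · /- Heaviness on the pattern. -/
    intro j
    rw [Finsupp.add_apply, hP]
    simp only [if_true]
    omega

end Summit.ValiantsHypothesis.ValiantsHypothesis.Theorems.DivisionGap.PerMultiplesHard.HeavyTable
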